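import Literature.AlgebraicGeometry.HodgeTheory.FermatSurfaceModelSpecialFibres
import Literature.AlgebraicGeometry.HodgeTheory.FermatSurfaceModelInfinity
import Literature.AlgebraicGeometry.HodgeTheory.FermatSurfaceModelLineFunction
import Literature.AlgebraicGeometry.HodgeTheory.FermatHodgeCharacters
import HarnessLib

/-!
# A `χ_β`-eigen holomorphic `2`-form on a model of the Fermat surface vanishes at the generic points when `|β| = 2`

Family `hodge`, layer `Literature/AlgebraicGeometry/HodgeTheory`. PROOF FILE (theorems only; no
definition, no named fact — D-0026): the heart of the analytic leaf `hmodel` of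
`AokiShioda1983_eigenline_le_neronSeveri_holds_of_modelEigenforms` (`FermatSurfaceEigenformsOnModels`).
Let `(M, ψ, Φ)` be a holomorphic model of the Fermat surface `X²ₘ` with its `μₘ⁴`-action
(`dim_ℂ E = 2`, `ψ` an embedding onto `V(Σ xᵢᵐ)` with holomorphic coordinates, `Φ_a`
holomorphic over `[x] ↦ [a • x]`), `β ∈ 𝔅²ₘ` a Hodge character, and `η` a smooth closed
`2`-form of type `(2,0)` with `Φ_a^* η = χ_β(a) η` for all `a`. Then
(`modelEigenform_apply_eq_zero_of_generic`) **`η x = 0` at every `x ∈ M₀` none of whose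
affine coordinates `y_r(x)` vanishes.**

Proof — Shioda's (1.7) ("`V(β) ⊂ H^{2,0}` iff `|β| = 1`") as a Liouville argument on the
`μₘ³`-quotient plane. With the affine volume form `ω₀` and the ratio `f₀ = η(e)/ω₀(e)`
(holomorphic on `M₀`, `η = f₀ ω₀`, `f₀(Φ_a x) ∏ a_r/a₀ = χ_β(a) f₀(x)`; `FermatSurfaceModelRatio`),
the quotient `F = f₀ / ∏ y_r^{⟨β_r⟩−1}` is `μₘ⁴`-invariant (`FermatSurfaceModelFibres`) and its
restriction to the line `u₂ = λ u₁ + μ` of the `u`-plane (`u_r = y_rᵐ`) is a function `G` on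
`ℂ`, holomorphic off the three points where the line meets `u₁ u₂ u₃ = 0`
(`differentiableAt_lineFunction`), bounded near them (`exists_bound_near_specialFibre`: the
eigen-character forces `f₀` to vanish to order `⟨β_i⟩ − 1` along `{y_i = 0}`), hence entire
(`exists_differentiable_eqOn_of_bddAbove`), and tending to `0` at infinity because `|β| = 2`
makes `F` vanish on the fibre at infinity (`exists_small_near_infinityFibre`: there
`F = f₁ z₀^{N}/(⋯)` with `N = 1 + ⟨β₁⟩ + ⟨β₂⟩ + ⟨β₃⟩ − m ≥ 2`). So `G ≡ 0`
(`eq_zero_of_differentiable_of_tendsto_cocompact`), i.e. `F = 0`, `f₀ = 0` and `η = f₀ ω₀ = 0`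
along the generic fibres; through every generic point passes a generic line (`λ` chosen outside
a finite set).

## References

* [Shioda1979HodgeFermat] T. Shioda, The Hodge conjecture for Fermat varieties, Math. Ann. 245
  (1979) 175–184, §1 (1.7).
* [AokiShioda1983] N. Aoki, T. Shioda, Generators of the Néron–Severi group of a Fermat surface,
  Progr. Math. 35 (1983), §2 (2.1)–(2.2).
* [Rudin1987] W. Rudin, Real and Complex Analysis (1987), Thm. 10.20, Thm. 10.23.
-/

noncomputable section

open scoped Manifold ContDiff Topology LinearAlgebra.Projectivization
open Set Filter Projectivization Function

namespace Literature.AlgebraicGeometry.HodgeTheory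

open Literature.AlgebraicGeometry.Motives Literature.NumberTheory.Transcendental
  Literature.Geometry.Kaehler Literature.Analysis.Complex

/-! ### Arithmetic of a Hodge character of the surface -/

/-- For a Hodge character `β ∈ 𝔅²ₘ`: every `⟨β_r⟩ ≥ 1`, `Σ_r ⟨β_r⟩ = 2m`, hence
`⟨β₁⟩ + ⟨β₂⟩ + ⟨β₃⟩ ≥ m + 1` and `a₀^{Σ⟨β_r⟩} = 1` on `μₘ⁴`.
[cite: AokiShioda1983, §2 (2.2)] [cite: Shioda1979HodgeFermat, §1] -/
theorem isHodge_surface_data {m : ℕ} [NeZero m] {β : Fin (2 + 2) → ZMod m}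
    (hβ : FermatCharacter.IsHodge β) :
    (∀ r, r ≠ 0 → 1 ≤ (β r).val) ∧ (∑ r, (β r).val = 2 * m) ∧
      (m ≤ (β 1).val + (β 2).val + (β 3).val) ∧
      ∀ a : fermatGroup 2 m, (((a : Fin (2 + 2) → ℂˣ) 0 : ℂˣ) : ℂ) ^ (∑ r, (β r).val) = 1 := by
  obtain ⟨⟨hne, -⟩, hlen⟩ := hβ
  have hval : ∀ r, 1 ≤ (β r).val := fun r ↦ by
    have h := hne r
    rw [Ne, ← ZMod.val_eq_zero] at h
    omega
  have hsum : ∑ r, (β r).val = 2 * m := by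
    have h := hlen 1
    simp only [Units.val_one, one_mul, FermatCharacter.normSum] at h
    omega
  refine ⟨fun r _ ↦ hval r, hsum, ?_, fun a ↦ ?_⟩
  · have h0 := ZMod.val_lt (β 0)
    rw [Fin.sum_univ_four] at hsum
    omega
  · have ha : ((((a : Fin (2 + 2) → ℂˣ) 0 : ℂˣ) : ℂ)) ^ m = 1 := by
      rw [← Units.val_pow_eq_pow_val, mem_fermatGroup_iff.mp a.2 0, Units.val_one]
    rw [hsum, mul_comm, pow_mul, ha, one_pow]

section Surface

variable {m : ℕ} {E : Type*} [NormedAddCommGroup E] [NormedSpace ℂ E] [FiniteDimensional ℂ E]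
  {M : Type*} [TopologicalSpace M] [ChartedSpace E M] [IsManifold 𝓘(ℂ, E) ω M]
  [IsManifold 𝓘(ℝ, E) ∞ M] {ψ : M → ℙ ℂ (Fin (2 + 2) → ℂ)} {Φ : fermatGroup 2 m → M → M}

/-! ### Points of `M₀` with `y₁ ≠ 0` lie in `M₁` -/

omit [FiniteDimensional ℂ E] [TopologicalSpace M] [ChartedSpace E M] [IsManifold 𝓘(ℂ, E) ω M]
  [IsManifold 𝓘(ℝ, E) ∞ M] in
/-- A point of `M₀` with `y₁ ≠ 0` lies in `M₁`, with `Z̃₁ = y₁⁻¹ • Z̃₀`. [folklore] -/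
theorem mem_liftDomain_one_of {x : M} (hx : x ∈ liftDomain ψ 0) (h1 : projLift ψ 0 x 1 ≠ 0) :
    x ∈ liftDomain ψ 1 ∧ projLift ψ 1 x = (projLift ψ 0 x 1)⁻¹ • projLift ψ 0 x := by
  have hv : (projLift ψ 0 x 1)⁻¹ • projLift ψ 0 x ≠ 0 :=
    smul_ne_zero (inv_ne_zero h1) (projLift_ne_zero ψ 0 x)
  have hmk : Projectivization.mk ℂ _ hv = ψ x := by
    rw [← mk_projLift ψ hx]
    exact (Projectivization.mk_eq_mk_iff' ℂ _ _ hv (projLift_ne_zero ψ 0 x)).mpr ⟨_, rfl⟩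
  exact projLift_eq_of_mk_eq ψ hv hmk (by simp [inv_mul_cancel₀ h1])

/-! ### The vanishing at the generic points -/

variable (hΦψ : ∀ (a : fermatGroup 2 m) (x : M), ψ (Φ a x) =
    Projectivization.mk ℂ ((a : Fin (2 + 2) → ℂˣ) • (ψ x).rep)
      ((smul_ne_zero_iff_ne (a : Fin (2 + 2) → ℂˣ)).mpr (Projectivization.rep_nonzero _)))

include hΦψ in
/-- **A `χ_β`-eigen closed `(2,0)`-form, `β ∈ 𝔅²ₘ`, on a holomorphic model of the Fermat surface
vanishes at every point of `M₀` with no vanishing affine coordinate.** See the module docstring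
for the argument (Shioda (1.7) as a Liouville argument on a generic line of the `μₘ³`-quotient
plane). [cite: Shioda1979HodgeFermat, §1 (1.7)] [cite: AokiShioda1983, §2 (2.1)–(2.2)]
[cite: Rudin1987, Thm. 10.20 and Thm. 10.23] -/
theorem modelEigenform_apply_eq_zero_of_generic [NeZero m] (h2 : Module.finrank ℂ E = 2)
    (hψ : Topology.IsEmbedding ψ) (hrange : Set.range ψ = projZeroLocus {fermatPolynomial ℂ 2 m})
    (hhol : HasHolomorphicCoords E ψ) (hΦd : ∀ a, MDifferentiable 𝓘(ℂ, E) 𝓘(ℂ, E) (Φ a))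
    {β : Fin (2 + 2) → ZMod m} (hβ : FermatCharacter.IsHodge β) {η : MForm 𝓘(ℝ, E) M ℂ 2}
    (hs : IsSmoothForm η) (hc : IsClosedForm η) (ht : IsOfType 2 0 η)
    (heig : ∀ a : fermatGroup 2 m, η.pullback 𝓘(ℝ, E) (Φ a) = ((fermatCharacter m β a : ℂˣ) : ℂ) • η)
    {x : M} (hx : x ∈ liftDomain ψ 0) (hne : ∀ r, projLift ψ 0 x r ≠ 0) : η x = 0 := by
  have hm : m ≠ 0 := NeZero.ne m
  have hψc := hψ.continuous
  have hinj := hψ.injective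
  obtain ⟨hb, hsum2, hN, hsum⟩ := isHodge_surface_data hβ
  -- the frame, the volume forms, the ratio functions, the quotient function
  set bE := Module.finBasisOfFinrankEq ℂ E h2 with hbE
  set e : Fin 2 → E := ⇑bE with hedef
  have he : LinearIndependent ℂ e := bE.linearIndependent
  set ω₀ : MForm 𝓘(ℝ, E) M ℂ 2 := fun y ↦ show E [⋀^Fin 2]→L[ℝ] ℂ from
    (residueFormula (E := E) ψ (fermatPolynomial ℂ 2 m) 1 0 0 y).restrictScalars ℝ with hω₀def
  set ω₁ : MForm 𝓘(ℝ, E) M ℂ 2 := fun y ↦ show E [⋀^Fin 2]→L[ℝ] ℂ from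
    (residueFormula (E := E) ψ (fermatPolynomial ℂ 2 m) 1 1 1 y).restrictScalars ℝ with hω₁def
  have hω₀ : ∀ y, ω₀ y = (show E [⋀^Fin 2]→L[ℝ] ℂ from
    (residueFormula (E := E) ψ (fermatPolynomial ℂ 2 m) 1 0 0 y).restrictScalars ℝ) := fun y ↦ rfl
  have hω₁ : ∀ y, ω₁ y = (show E [⋀^Fin 2]→L[ℝ] ℂ from
    (residueFormula (E := E) ψ (fermatPolynomial ℂ 2 m) 1 1 1 y).restrictScalars ℝ) := fun y ↦ rfl
  set f₀ : M → ℂ := fun y ↦ η y e / ω₀ y e with hf₀def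
  set f₁ : M → ℂ := fun y ↦ η y e / ω₁ y e with hf₁def
  have hf₀ : ∀ y, f₀ y = η y e / ω₀ y e := fun y ↦ rfl
  have hf₁ : ∀ y, f₁ y = η y e / ω₁ y e := fun y ↦ rfl
  have hf₀d : ∀ y ∈ liftDomain ψ 0, MDifferentiableAt 𝓘(ℂ, E) 𝓘(ℂ, ℂ) f₀ y := fun y hy ↦
    mdifferentiableAt_fermatRatio hψ hrange hhol h2 he hs hc ht hω₀ hf₀ hy
  have hf₁c : ∀ y ∈ liftDomain ψ 1, ContinuousAt f₁ y := fun y hy ↦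
    (mdifferentiableAt_fermatRatio hψ hrange hhol h2 he hs hc ht hω₁ hf₁ hy).continuousAt
  have hf₀sym : ∀ (a : fermatGroup 2 m) (y : M), y ∈ liftDomain ψ 0 →
      f₀ (Φ a y) * ∏ r, ((((a : Fin (2 + 2) → ℂˣ) r : ℂˣ) : ℂ) / (((a : Fin (2 + 2) → ℂˣ) 0 : ℂˣ) : ℂ)) =
        ((fermatCharacter m β a : ℂˣ) : ℂ) * f₀ y := fun a y hy ↦
    fermatRatio_symm (hΦψ a) hψ hrange hhol h2 (hΦd a) he ht (heig a) hω₀ hf₀ hy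
  have htrans : ∀ y, y ∈ liftDomain ψ 0 → y ∈ liftDomain ψ 1 →
      f₀ y * projLift ψ 1 y 0 ^ ((m : ℤ) - 4) = f₁ y := fun y hy₀ hy₁ ↦
    fermatRatio_zero_mul_zpow_eq_one hψc hrange hhol e hω₀ hω₁ hf₀ hf₁ hy₀ hy₁
  set Fq : M → ℂ := fun y ↦ f₀ y / ∏ r, projLift ψ 0 y r ^ ((β r).val - 1) with hFqdef
  have hFq : ∀ y, Fq y = f₀ y / ∏ r, projLift ψ 0 y r ^ ((β r).val - 1) := fun y ↦ rfl
  -- the `u`-coordinates of `x` and a generic line through them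
  set u₁ : ℂ := projLift ψ 0 x 1 ^ m with hu₁
  set u₂ : ℂ := projLift ψ 0 x 2 ^ m with hu₂
  set u₃ : ℂ := projLift ψ 0 x 3 ^ m with hu₃
  have hu₁0 : u₁ ≠ 0 := pow_ne_zero _ (hne 1)
  have hu₂0 : u₂ ≠ 0 := pow_ne_zero _ (hne 2)
  have hu₃0 : u₃ ≠ 0 := pow_ne_zero _ (hne 3)
  have husum : 1 + u₁ + u₂ + u₃ = 0 := by
    have h := sum_projLift_pow_eq_zero hrange.le hx
    rw [Fin.sum_univ_four, projLift_apply_self, one_pow] at h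
    exact h
  obtain ⟨lam, hlamS⟩ := Infinite.exists_notMem_finset
    ({0, -1, u₂ / u₁, (u₂ + 1) / u₁, u₂ / (u₁ + 1)} : Finset ℂ)
  simp only [Finset.mem_insert, Finset.mem_singleton, not_or] at hlamS
  obtain ⟨hlam0, hlam1', hlamA, hlamB, hlamC⟩ := hlamS
  have hlam1 : 1 + lam ≠ 0 := fun h ↦ hlam1' (by linear_combination h)
  set mu : ℂ := u₂ - lam * u₁ with hmu
  have hmu0 : mu ≠ 0 := fun h ↦ hlamA (by rw [eq_div_iff hu₁0]; linear_combination -h)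
  have hmu1 : 1 + mu ≠ 0 := fun h ↦ hlamB (by rw [eq_div_iff hu₁0]; linear_combination -h)
  have hmulam : mu ≠ lam := by
    intro h
    by_cases h1 : u₁ + 1 = 0
    · apply hu₂0; linear_combination h + lam * h1
    · exact hlamC (by rw [eq_div_iff h1]; linear_combination -h)
  have hline_x : u₂ = lam * u₁ + mu := by rw [hmu]; ring
  -- the line function `G`
  classical
  set G : ℂ → ℂ := fun t ↦ if h : ∃ x' : M, x' ∈ liftDomain ψ 0 ∧ (∀ r, projLift ψ 0 x' r ≠ 0) ∧
      projLift ψ 0 x' 1 ^ m = t ∧ projLift ψ 0 x' 2 ^ m = lam * t + mu then Fq h.choose else 0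
    with hGdef
  have hG : ∀ (t : ℂ) (x' : M), x' ∈ liftDomain ψ 0 → (∀ r, projLift ψ 0 x' r ≠ 0) →
      projLift ψ 0 x' 1 ^ m = t → projLift ψ 0 x' 2 ^ m = lam * t + mu → G t = Fq x' := by
    intro t x' hx' hne' h1 h2'
    have hex : ∃ x' : M, x' ∈ liftDomain ψ 0 ∧ (∀ r, projLift ψ 0 x' r ≠ 0) ∧
        projLift ψ 0 x' 1 ^ m = t ∧ projLift ψ 0 x' 2 ^ m = lam * t + mu := ⟨x', hx', hne', h1, h2'⟩
    have hGt : G t = Fq hex.choose := by simp only [hGdef, dif_pos hex]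
    obtain ⟨hc₀, hcne, hc1, hc2⟩ := hex.choose_spec
    rw [hGt]
    -- same fibre
    refine fermatQuotientFn_eq_of_pow_eq hΦψ hinj hb hsum hf₀sym hFq hx' hc₀ (fun r ↦ ?_) hne'
    have hr0 : projLift ψ 0 x' 0 ^ m = projLift ψ 0 hex.choose 0 ^ m := by
      rw [projLift_apply_self, projLift_apply_self]
    have hr1 : projLift ψ 0 x' 1 ^ m = projLift ψ 0 hex.choose 1 ^ m := by rw [h1, hc1]
    have hr2 : projLift ψ 0 x' 2 ^ m = projLift ψ 0 hex.choose 2 ^ m := by rw [h2', hc2]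
    have hr3 : projLift ψ 0 x' 3 ^ m = projLift ψ 0 hex.choose 3 ^ m := by
      have ha := sum_projLift_pow_eq_zero hrange.le hx'
      have hb' := sum_projLift_pow_eq_zero hrange.le hc₀
      rw [Fin.sum_univ_four] at ha hb'
      rw [hr0, hr1, hr2] at ha
      linear_combination ha - hb'
    fin_cases r
    exacts [hr0, hr1, hr2, hr3]
  -- the three special parameters
  set t₂ : ℂ := -mu / lam with ht₂
  set t₃ : ℂ := -(1 + mu) / (1 + lam) with ht₃
  have hgen : ∀ t : ℂ, t ≠ 0 → t ≠ t₂ → t ≠ t₃ →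
      t ≠ 0 ∧ lam * t + mu ≠ 0 ∧ 1 + t + (lam * t + mu) ≠ 0 := by
    intro t h0 h2' h3
    refine ⟨h0, fun h ↦ h2' ?_, fun h ↦ h3 ?_⟩
    · rw [ht₂, eq_div_iff hlam0]; linear_combination h
    · rw [ht₃, eq_div_iff hlam1]; linear_combination h
  set T : Finset ℂ := {0, t₂, t₃} with hT
  have hTc : ∀ t : ℂ, t ∉ T → t ≠ 0 ∧ lam * t + mu ≠ 0 ∧ 1 + t + (lam * t + mu) ≠ 0 := by
    intro t htT
    simp only [hT, Finset.mem_insert, Finset.mem_singleton, not_or] at htT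
    exact hgen t htT.1 htT.2.1 htT.2.2
  -- (G1) holomorphy off `T`
  have hGdiff : DifferentiableOn ℂ G (↑T)ᶜ := by
    intro t htT
    obtain ⟨h0, h1, h2'⟩ := hTc t htT
    exact (differentiableAt_lineFunction hψ hrange hhol h2 hf₀d hFq lam mu hG h0 h1 h2').differentiableWithinAt
  -- (G2) boundedness near the special parameters
  have hGbdd : ∀ t₀ ∈ T, ∃ U ∈ 𝓝 t₀, BddAbove (norm ∘ G '' (U \ {t₀})) := by
    -- a punctured neighbourhood of a point of `T` avoiding the rest of `T`
    have hpunct : ∀ t₀ : ℂ, ∀ᶠ t in 𝓝 t₀, t ≠ t₀ → t ∉ T := by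
      intro t₀
      have hfin : ∀ s ∈ T, s ≠ t₀ → ∀ᶠ t in 𝓝 t₀, t ≠ s := fun s _ hs ↦
        (continuousAt_id.eventually_ne (Ne.symm hs) :)
      have : ∀ᶠ t in 𝓝 t₀, ∀ s ∈ T, s ≠ t₀ → t ≠ s :=
        (T.eventually_all.2 fun s hs ↦ (eventually_imp_distrib_left.2 (hfin s hs) :))
          |>.mono fun t h s hs hst ↦ h s hs hst
      filter_upwards [this] with t h htt₀ htT
      exact h t htT (fun hst ↦ htt₀ (hst ▸ rfl)) rfl
    -- the three bounds
    obtain ⟨δ₁, hδ₁, C₁, hC₁⟩ := exists_bound_near_specialFibre hΦψ hψ hrange hhol h2 hΦd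
      (i := 1) (j := 2) (l := 3) (fun r ↦ by fin_cases r <;> simp) (by decide) (by decide) (by decide)
      (by decide) (by decide) (by decide) hb hsum hf₀d hf₀sym hFq lam hmu0 hmu1
    obtain ⟨δ₂, hδ₂, C₂, hC₂⟩ := exists_bound_near_specialFibre hΦψ hψ hrange hhol h2 hΦd
      (i := 2) (j := 1) (l := 3) (fun r ↦ by fin_cases r <;> simp) (by decide) (by decide) (by decide)
      (by decide) (by decide) (by decide) hb hsum hf₀d hf₀sym hFq lam⁻¹ (B := -mu / lam)
      (div_ne_zero (neg_ne_zero.mpr hmu0) hlam0)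
      (by rw [← ht₂]; intro h; apply hmulam; rw [ht₂] at h; field_simp at h; linear_combination -h)
    obtain ⟨δ₃, hδ₃, C₃, hC₃⟩ := exists_bound_near_specialFibre hΦψ hψ hrange hhol h2 hΦd
      (i := 3) (j := 1) (l := 2) (fun r ↦ by fin_cases r <;> simp) (by decide) (by decide) (by decide)
      (by decide) (by decide) (by decide) hb hsum hf₀d hf₀sym hFq (-(1 + lam)⁻¹)
      (B := -(1 + mu) / (1 + lam)) (div_ne_zero (neg_ne_zero.mpr hmu1) hlam1)
      (by intro h; apply hmulam; field_simp at h; linear_combination -h)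
    intro t₀ ht₀T
    -- the representation `G t = F x'` near `t₀`
    simp only [hT, Finset.mem_insert, Finset.mem_singleton] at ht₀T
    rcases ht₀T with rfl | rfl | rfl
    · -- `t₀ = 0`: `‖y₁‖ᵐ = ‖t‖` small
      have hsmall : ∀ᶠ t in 𝓝 (0 : ℂ), ‖t‖ < δ₁ ^ m := by
        have : (fun t : ℂ ↦ ‖t‖) 0 < δ₁ ^ m := by simpa using pow_pos hδ₁ m
        exact continuous_norm.continuousAt.eventually (gt_mem_nhds this)
      obtain ⟨U, hU, hUP⟩ := ((hpunct 0).and hsmall).exists_mem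
      refine ⟨U, hU, ⟨C₁, ?_⟩⟩
      rintro _ ⟨t, ⟨htU, ht0⟩, rfl⟩
      obtain ⟨hP, htδ⟩ := hUP t htU
      obtain ⟨h0, h1, h2'⟩ := hTc t (hP ht0)
      obtain ⟨x', hx', hne', hy1, hy2⟩ := exists_point_over_line (ψ := ψ) hrange lam mu h0 h1 h2'
      rw [Function.comp_apply, hG t x' hx' hne' hy1 hy2]
      refine hC₁ x' hx' hne' ?_ (by rw [hy2, hy1])
      have : ‖projLift ψ 0 x' 1‖ ^ m < δ₁ ^ m := by rw [← norm_pow, hy1]; exact htδ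
      exact lt_of_pow_lt_pow_left₀ m hδ₁.le this
    · -- `t₀ = t₂`: `‖y₂‖ᵐ = ‖λ‖ ‖t - t₂‖` small
      have hsmall : ∀ᶠ t in 𝓝 t₂, ‖lam * t + mu‖ < δ₂ ^ m := by
        have hcont : ContinuousAt (fun t : ℂ ↦ ‖lam * t + mu‖) t₂ := by fun_prop
        have h0 : (fun t : ℂ ↦ ‖lam * t + mu‖) t₂ < δ₂ ^ m := by
          have : lam * t₂ + mu = 0 := by rw [ht₂]; field_simp; ring
          simp only [this, norm_zero]; exact pow_pos hδ₂ m
        exact hcont.eventually (gt_mem_nhds h0)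
      obtain ⟨U, hU, hUP⟩ := ((hpunct t₂).and hsmall).exists_mem
      refine ⟨U, hU, ⟨C₂, ?_⟩⟩
      rintro _ ⟨t, ⟨htU, ht0⟩, rfl⟩
      obtain ⟨hP, htδ⟩ := hUP t htU
      obtain ⟨h0, h1, h2'⟩ := hTc t (hP ht0)
      obtain ⟨x', hx', hne', hy1, hy2⟩ := exists_point_over_line (ψ := ψ) hrange lam mu h0 h1 h2'
      rw [Function.comp_apply, hG t x' hx' hne' hy1 hy2]
      refine hC₂ x' hx' hne' ?_ ?_
      · have : ‖projLift ψ 0 x' 2‖ ^ m < δ₂ ^ m := by rw [← norm_pow, hy2]; exact htδ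
        exact lt_of_pow_lt_pow_left₀ m hδ₂.le this
      · rw [hy1, hy2]; field_simp; ring
    · -- `t₀ = t₃`: `‖y₃‖ᵐ = ‖1 + λ‖ ‖t - t₃‖` small
      have hsmall : ∀ᶠ t in 𝓝 t₃, ‖-(1 + t + (lam * t + mu))‖ < δ₃ ^ m := by
        have hcont : ContinuousAt (fun t : ℂ ↦ ‖-(1 + t + (lam * t + mu))‖) t₃ := by fun_prop
        have h0 : (fun t : ℂ ↦ ‖-(1 + t + (lam * t + mu))‖) t₃ < δ₃ ^ m := by
          have : -(1 + t₃ + (lam * t₃ + mu)) = 0 := by rw [ht₃]; field_simp; ring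
          simp only [this, norm_zero]; exact pow_pos hδ₃ m
        exact hcont.eventually (gt_mem_nhds h0)
      obtain ⟨U, hU, hUP⟩ := ((hpunct t₃).and hsmall).exists_mem
      refine ⟨U, hU, ⟨C₃, ?_⟩⟩
      rintro _ ⟨t, ⟨htU, ht0⟩, rfl⟩
      obtain ⟨hP, htδ⟩ := hUP t htU
      obtain ⟨h0, h1, h2'⟩ := hTc t (hP ht0)
      obtain ⟨x', hx', hne', hy1, hy2⟩ := exists_point_over_line (ψ := ψ) hrange lam mu h0 h1 h2'
      rw [Function.comp_apply, hG t x' hx' hne' hy1 hy2]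
      have hy3 : projLift ψ 0 x' 3 ^ m = -(1 + t + (lam * t + mu)) := by
        have h := sum_projLift_pow_eq_zero hrange.le hx'
        rw [Fin.sum_univ_four, projLift_apply_self, one_pow, hy1, hy2] at h
        linear_combination h
      refine hC₃ x' hx' hne' ?_ ?_
      · have : ‖projLift ψ 0 x' 3‖ ^ m < δ₃ ^ m := by rw [← norm_pow, hy3]; exact htδ
        exact lt_of_pow_lt_pow_left₀ m hδ₃.le this
      · rw [hy1, hy3]; field_simp; ring
  -- (G3) an entire function agreeing with `G` off `T`
  obtain ⟨g, hgd, hgG⟩ := exists_differentiable_eqOn_of_bddAbove hGdiff hGbdd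
  -- (G4) decay at infinity
  have hg0 : Tendsto g (cocompact ℂ) (𝓝 0) := by
    rw [Metric.tendsto_nhds]
    intro ε hε
    obtain ⟨δ, hδ, hδP⟩ := exists_small_near_infinityFibre hΦψ hψ hrange hhol h2 hb hsum hN hf₁c
      hf₀sym htrans hFq mu hlam0 hlam1 (half_pos hε)
    -- radius beyond `T` and beyond `δ^{-m}`
    set R : ℝ := max (max ‖t₂‖ ‖t₃‖) (δ⁻¹ ^ m) + 1 with hR
    have hmem : (Metric.closedBall (0 : ℂ) R)ᶜ ∈ cocompact ℂ :=
      Metric.mem_cocompact_of_closedBall_compl_subset 0 ⟨R, Subset.rfl⟩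
    filter_upwards [hmem] with t ht
    rw [mem_compl_iff, Metric.mem_closedBall, dist_zero_right, not_le] at ht
    have hRle : max (max ‖t₂‖ ‖t₃‖) (δ⁻¹ ^ m) < ‖t‖ := by rw [hR] at ht; linarith
    have htT : t ∉ T := by
      simp only [hT, Finset.mem_insert, Finset.mem_singleton, not_or]
      refine ⟨?_, ?_, ?_⟩
      · rintro rfl; simp at ht; rw [hR] at ht; linarith [le_max_right (max ‖t₂‖ ‖t₃‖) (δ⁻¹ ^ m),
          pow_nonneg (inv_nonneg.mpr hδ.le) m]
      · rintro rfl; linarith [le_max_left ‖t₂‖ ‖t₃‖, le_max_left (max ‖t₂‖ ‖t₃‖) (δ⁻¹ ^ m)]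
      · rintro rfl; linarith [le_max_right ‖t₂‖ ‖t₃‖, le_max_left (max ‖t₂‖ ‖t₃‖) (δ⁻¹ ^ m)]
    obtain ⟨h0, h1, h2'⟩ := hTc t htT
    obtain ⟨x', hx', hne', hy1, hy2⟩ := exists_point_over_line (ψ := ψ) hrange lam mu h0 h1 h2'
    rw [dist_zero_right, hgG htT, hG t x' hx' hne' hy1 hy2]
    obtain ⟨hx'1, hz⟩ := mem_liftDomain_one_of hx' (hne' 1)
    have hz0 : projLift ψ 1 x' 0 = (projLift ψ 0 x' 1)⁻¹ := by
      rw [hz, Pi.smul_apply, projLift_apply_self, smul_eq_mul, mul_one]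
    have hz2 : projLift ψ 1 x' 2 = (projLift ψ 0 x' 1)⁻¹ * projLift ψ 0 x' 2 := by
      rw [hz, Pi.smul_apply, smul_eq_mul]
    refine lt_of_le_of_lt (hδP x' hx' hx'1 hne' ?_ ?_) (half_lt_self hε)
    · -- `‖z₀‖ = ‖t‖^{-1/m} < δ`
      rw [hz0, norm_inv]
      have htpow : ‖projLift ψ 0 x' 1‖ ^ m = ‖t‖ := by rw [← norm_pow, hy1]
      have hδt : δ⁻¹ ^ m < ‖projLift ψ 0 x' 1‖ ^ m := by
        rw [htpow]; exact lt_of_le_of_lt (le_max_right _ _) hRle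
      have hlt : δ⁻¹ < ‖projLift ψ 0 x' 1‖ := lt_of_pow_lt_pow_left₀ m (norm_nonneg _) hδt
      have hpos : 0 < ‖projLift ψ 0 x' 1‖ := lt_trans (inv_pos.mpr hδ) hlt
      rwa [inv_lt_comm₀ hpos hδ]
    · -- the line in the `z`-coordinates: `z₂ᵐ = μ z₀ᵐ + λ`
      rw [hz2, hz0, mul_pow, inv_pow, hy1, hy2]
      field_simp
      ring
  have hgz : g = 0 := eq_zero_of_differentiable_of_tendsto_cocompact hgd hg0
  -- (G5) conclusion at `x`
  have hxT : u₁ ∉ T := by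
    simp only [hT, Finset.mem_insert, Finset.mem_singleton, not_or]
    refine ⟨hu₁0, fun h ↦ hu₂0 ?_, fun h ↦ hu₃0 ?_⟩
    · rw [hline_x, h, ht₂]; field_simp; ring
    · have : u₃ = -(1 + u₁ + (lam * u₁ + mu)) := by rw [← hline_x]; linear_combination husum
      rw [this, h, ht₃]; field_simp; ring
  have hGx : G u₁ = Fq x := hG u₁ x hx hne rfl hline_x
  have hFx : Fq x = 0 := by
    rw [← hGx, ← hgG hxT, hgz, Pi.zero_apply]
  have hf₀x : f₀ x = 0 := by
    have hprod : ∏ r, projLift ψ 0 x r ^ ((β r).val - 1) ≠ 0 :=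
      Finset.prod_ne_zero_iff.mpr fun r _ ↦ pow_ne_zero _ (hne r)
    have := hFq x
    rw [hFx, eq_comm, div_eq_zero_iff] at this
    exact this.resolve_right hprod
  rw [eq_fermatRatio_smul hψ hrange hhol h2 he ht hω₀ hf₀ hx, hf₀x, zero_smul]

end Surface

end Literature.AlgebraicGeometry.HodgeTheory

end
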